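import Literature.Topology.FourManifolds.VertexConeDifferential
import Literature.Topology.FourManifolds.SectorBounds
import HarnessLib

/-!
# The smooth sectors at a vertex of the triangulation

Topic `Literature/Topology/FourManifolds`; input of the vertex stage of the smoothing sweep
(Munkres, Ann. of Math. 72 (1960), §5; Campbell–D'Onofrio–Vítek (2026), Lemma 3.2).  For a
top simplex `t` of the owner complex `K j` the transition `pd₂ j ∘ (pd₁ j).symm` of the two PD
charts is, on the curved sector `pd₁ j '' conv t`, the smooth SECTOR MAP
`sectorMap = mdl₂ ∘ sectorChart.symm` (chosen `C^∞` models `mdl₁`, `mdl₂` of `S` on `t`; the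
immersion chart `sectorChart = mdl₁` about the compact `conv t`, `ImmersionChart.lean`):

* `SweepData.mdl₁`, `SweepData.mdl₂`, `SweepData.sectorChart`, `SweepData.sectorMap` (choices) and
  their defining properties;
* `SweepData.pd₂_eq_sectorMap` — `pd₂ j q = sectorMap (pd₁ j q)` for `q ∈ conv t`, and
  `SweepData.trans_eventuallyEq_sectorMap` — near the image of an INTERIOR point of `conv t` the
  transition agrees with the sector map as a germ;
* `SweepData.exists_sectorBounds` — at a vertex `a ∈ t`: a ball `closedBall (pd₁ j a) R₁` inside
  the chart target on which the sector map has derivative bounded below by `m ‖w‖` and quadratic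
  Euler defect `κ ‖z - z₁‖²` (`SectorBounds.lean`).

Everything is proved; the definitions are choices; no named facts.

## References

* J. R. Munkres, *Obstructions to the smoothing of piecewise-differentiable homeomorphisms*, Ann.
  of Math. (2) 72 (1960), 521–554, §5. [Munkres1960]
* D. Campbell, L. D'Onofrio, T. Vítek, *Diffeomorphic approximation of piecewise affine
  homeomorphisms*, J. Geom. Anal. 36 (2026), Lemma 3.2. [CampbellDonofrioVitek2026]
-/

noncomputable section

open Set Function Metric Filter
open scoped Topology Manifold ContDiff

namespace Literature.Topology.FourManifolds

universe u

/-- Local notation: `𝔼 n` is the model Euclidean space `EuclideanSpace ℝ (Fin n)`. -/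
local notation "𝔼 " n:arg => EuclideanSpace ℝ (Fin n)

variable {n : ℕ} {M : Type u} [TopologicalSpace M] {c₁ c₂ : ChartedSpace (𝔼 n) M}

namespace SweepData

variable (S : SweepData n M c₁ c₂)

section Models

variable (j : S.ι) (t : Finset (𝔼 n)) (ht : t ∈ (S.K j).faces) (hc : t.card = n + 1)

/-- A chosen `C^∞` model of the first PD chart on the top simplex `t`. [folklore] -/
def mdl₁ : (𝔼 n) → 𝔼 n := Classical.choose (S.model₁ j t ht hc)

/-- A chosen `C^∞` model of the second PD chart on the top simplex `t`. [folklore] -/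
def mdl₂ : (𝔼 n) → 𝔼 n := Classical.choose (S.model₂ j t ht hc)

/-- The first model is `C^∞`. [folklore] -/
theorem mdl₁_contDiff : ContDiff ℝ ∞ (S.mdl₁ j t ht hc) := (Classical.choose_spec (S.model₁ j t ht hc)).1

/-- The second model is `C^∞`. [folklore] -/
theorem mdl₂_contDiff : ContDiff ℝ ∞ (S.mdl₂ j t ht hc) := (Classical.choose_spec (S.model₂ j t ht hc)).1

/-- The first model agrees with `pd₁ j` on `conv t`. [folklore] -/
theorem pd₁_eq_mdl₁ {q : 𝔼 n} (hq : q ∈ convexHull ℝ (t : Set (𝔼 n))) :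
    S.pd₁ j q = S.mdl₁ j t ht hc q :=
  (Classical.choose_spec (S.model₁ j t ht hc)).2.1 hq

/-- The second model agrees with `pd₂ j` on `conv t`. [folklore] -/
theorem pd₂_eq_mdl₂ {q : 𝔼 n} (hq : q ∈ convexHull ℝ (t : Set (𝔼 n))) :
    S.pd₂ j q = S.mdl₂ j t ht hc q :=
  (Classical.choose_spec (S.model₂ j t ht hc)).2.1 hq

/-- The first model has injective derivative on `conv t`. [folklore] -/
theorem injective_fderiv_mdl₁ {q : 𝔼 n} (hq : q ∈ convexHull ℝ (t : Set (𝔼 n))) :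
    Injective (fderiv ℝ (S.mdl₁ j t ht hc) q) :=
  (Classical.choose_spec (S.model₁ j t ht hc)).2.2 q hq

/-- The second model has injective derivative on `conv t`. [folklore] -/
theorem injective_fderiv_mdl₂ {q : 𝔼 n} (hq : q ∈ convexHull ℝ (t : Set (𝔼 n))) :
    Injective (fderiv ℝ (S.mdl₂ j t ht hc) q) :=
  (Classical.choose_spec (S.model₂ j t ht hc)).2.2 q hq

include ht in
/-- The closed simplex lies in the source of the first PD chart. [folklore] -/
theorem convexHull_subset_pd₁_source : convexHull ℝ (t : Set (𝔼 n)) ⊆ (S.pd₁ j).source :=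
  ((S.K j).convexHull_subset_space ht).trans (S.space_subset_pd₁_source j)

/-- **The sector chart exists**: an immersion chart of the first model about the compact
`conv t`. [folklore] -/
theorem exists_sectorChart : ∃ ef : OpenPartialHomeomorph (𝔼 n) (𝔼 n), ⇑ef = S.mdl₁ j t ht hc ∧
    convexHull ℝ (t : Set (𝔼 n)) ⊆ ef.source ∧ ContDiffOn ℝ ∞ ef.symm ef.target ∧
    ∀ x ∈ ef.source, ∃ L : (𝔼 n) ≃L[ℝ] 𝔼 n, HasFDerivAt (S.mdl₁ j t ht hc) (L : (𝔼 n) →L[ℝ] 𝔼 n) x := by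
  have hinj : InjOn (S.mdl₁ j t ht hc) (convexHull ℝ (t : Set (𝔼 n))) := by
    intro x hx y hy hxy
    rw [← S.pd₁_eq_mdl₁ j t ht hc hx, ← S.pd₁_eq_mdl₁ j t ht hc hy] at hxy
    exact (S.pd₁ j).injOn (S.convexHull_subset_pd₁_source j t ht hx)
      (S.convexHull_subset_pd₁_source j t ht hy) hxy
  exact exists_openPartialHomeomorph_of_injOn_isCompact (S.mdl₁_contDiff j t ht hc)
    (t.finite_toSet.isCompact_convexHull ℝ) hinj fun x hx => S.injective_fderiv_mdl₁ j t ht hc hx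

/-- **The sector chart** (a choice). [folklore] -/
def sectorChart : OpenPartialHomeomorph (𝔼 n) (𝔼 n) := Classical.choose (S.exists_sectorChart j t ht hc)

/-- The sector chart is the first model. [folklore] -/
theorem sectorChart_coe : ⇑(S.sectorChart j t ht hc) = S.mdl₁ j t ht hc :=
  (Classical.choose_spec (S.exists_sectorChart j t ht hc)).1

/-- The closed simplex lies in the source of the sector chart. [folklore] -/
theorem convexHull_subset_sectorChart_source :
    convexHull ℝ (t : Set (𝔼 n)) ⊆ (S.sectorChart j t ht hc).source :=
  (Classical.choose_spec (S.exists_sectorChart j t ht hc)).2.1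

/-- The inverse of the sector chart is smooth on the target. [folklore] -/
theorem contDiffOn_sectorChart_symm :
    ContDiffOn ℝ ∞ (S.sectorChart j t ht hc).symm (S.sectorChart j t ht hc).target :=
  (Classical.choose_spec (S.exists_sectorChart j t ht hc)).2.2.1

/-- The first model has invertible derivative on the source of the sector chart. [folklore] -/
theorem exists_hasFDerivAt_mdl₁ {x : 𝔼 n} (hx : x ∈ (S.sectorChart j t ht hc).source) :
    ∃ L : (𝔼 n) ≃L[ℝ] 𝔼 n, HasFDerivAt (S.mdl₁ j t ht hc) (L : (𝔼 n) →L[ℝ] 𝔼 n) x :=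
  (Classical.choose_spec (S.exists_sectorChart j t ht hc)).2.2.2 x hx

/-- **The sector map** `mdl₂ ∘ sectorChart.symm`. [folklore] -/
def sectorMap : (𝔼 n) → 𝔼 n := S.mdl₂ j t ht hc ∘ (S.sectorChart j t ht hc).symm

/-- The sector map is smooth on the target of the sector chart. [folklore] -/
theorem contDiffOn_sectorMap :
    ContDiffOn ℝ ∞ (S.sectorMap j t ht hc) (S.sectorChart j t ht hc).target :=
  (S.mdl₂_contDiff j t ht hc).comp_contDiffOn (S.contDiffOn_sectorChart_symm j t ht hc)

/-- The target of the sector chart is open. [folklore] -/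
theorem isOpen_sectorChart_target : IsOpen (S.sectorChart j t ht hc).target :=
  (S.sectorChart j t ht hc).open_target

/-- **On the sector the transition is the sector map**: `pd₂ j q = sectorMap (pd₁ j q)` for
`q ∈ conv t`. [folklore] -/
theorem pd₂_eq_sectorMap {q : 𝔼 n} (hq : q ∈ convexHull ℝ (t : Set (𝔼 n))) :
    S.pd₂ j q = S.sectorMap j t ht hc (S.pd₁ j q) := by
  simp only [sectorMap, comp_apply]
  rw [S.pd₁_eq_mdl₁ j t ht hc hq, ← S.sectorChart_coe j t ht hc,
    (S.sectorChart j t ht hc).left_inv (S.convexHull_subset_sectorChart_source j t ht hc hq)]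
  exact S.pd₂_eq_mdl₂ j t ht hc hq

/-- Images of points of the closed simplex lie in the target of the sector chart. [folklore] -/
theorem pd₁_mem_sectorChart_target {q : 𝔼 n} (hq : q ∈ convexHull ℝ (t : Set (𝔼 n))) :
    S.pd₁ j q ∈ (S.sectorChart j t ht hc).target := by
  rw [S.pd₁_eq_mdl₁ j t ht hc hq, ← S.sectorChart_coe j t ht hc]
  exact (S.sectorChart j t ht hc).map_source (S.convexHull_subset_sectorChart_source j t ht hc hq)

/-- **Near the image of an interior point of the simplex the transition IS the sector map** (as
a germ). [folklore] -/
theorem trans_eventuallyEq_sectorMap {q : 𝔼 n} (hq : q ∈ interior (convexHull ℝ (t : Set (𝔼 n)))) :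
    (fun z => S.pd₂ j ((S.pd₁ j).symm z)) =ᶠ[𝓝 (S.pd₁ j q)] S.sectorMap j t ht hc := by
  have hsub : interior (convexHull ℝ (t : Set (𝔼 n))) ⊆ (S.pd₁ j).source :=
    interior_subset.trans (S.convexHull_subset_pd₁_source j t ht)
  have hopen : IsOpen (S.pd₁ j '' interior (convexHull ℝ (t : Set (𝔼 n)))) :=
    (S.pd₁ j).isOpen_image_of_subset_source isOpen_interior hsub
  filter_upwards [hopen.mem_nhds ⟨q, hq, rfl⟩] with z hz
  obtain ⟨q', hq', rfl⟩ := hz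
  show S.pd₂ j ((S.pd₁ j).symm (S.pd₁ j q')) = S.sectorMap j t ht hc (S.pd₁ j q')
  rw [(S.pd₁ j).left_inv (hsub hq')]
  exact S.pd₂_eq_sectorMap j t ht hc (interior_subset hq')

/-- **Sector bounds at a vertex** `a ∈ t`: a closed ball around `z₁ = pd₁ j a` inside the target
of the sector chart on which the sector map is `C^∞` with derivative bounded below and
quadratic Euler defect. [cite: CampbellDonofrioVitek2026, Lemma 3.2] -/
theorem exists_sectorBounds {a : 𝔼 n} (ha : a ∈ t) :
    ∃ R₁ m κ : ℝ, 0 < R₁ ∧ 0 < m ∧ 0 ≤ κ ∧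
      closedBall (S.pd₁ j a) R₁ ⊆ (S.sectorChart j t ht hc).target ∧
      (∀ z ∈ closedBall (S.pd₁ j a) R₁, ∀ w, m * ‖w‖ ≤ ‖fderiv ℝ (S.sectorMap j t ht hc) z w‖) ∧
      (∀ z ∈ closedBall (S.pd₁ j a) R₁,
        ‖fderiv ℝ (S.sectorMap j t ht hc) z (z - S.pd₁ j a) -
          (S.sectorMap j t ht hc z - S.sectorMap j t ht hc (S.pd₁ j a))‖ ≤ κ * ‖z - S.pd₁ j a‖ ^ 2) := by
  have hat : a ∈ convexHull ℝ (t : Set (𝔼 n)) := subset_convexHull ℝ _ (Finset.mem_coe.2 ha)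
  have hz₁ := S.pd₁_mem_sectorChart_target j t ht hc hat
  -- the derivative of the sector map at `z₁` is invertible
  have hasrc := S.convexHull_subset_sectorChart_source j t ht hc hat
  obtain ⟨L₁, hL₁, hL₁s⟩ := exists_hasFDerivAt_symm_equiv (S.sectorChart j t ht hc)
    (S.sectorChart_coe j t ht hc) (S.mdl₁_contDiff j t ht hc) (S.contDiffOn_sectorChart_symm j t ht hc)
    hasrc
  obtain ⟨L₂, hL₂⟩ := exists_continuousLinearEquiv_eq_of_injective (S.injective_fderiv_mdl₂ j t ht hc hat)
  have hku : HasFDerivAt (S.mdl₂ j t ht hc) (L₂ : (𝔼 n) →L[ℝ] 𝔼 n)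
      ((S.sectorChart j t ht hc).symm (S.pd₁ j a)) := by
    rw [S.pd₁_eq_mdl₁ j t ht hc hat, ← S.sectorChart_coe j t ht hc,
      (S.sectorChart j t ht hc).left_inv hasrc, hL₂]
    exact ((S.mdl₂_contDiff j t ht hc).differentiable (by simp) a).hasFDerivAt
  have hz₁eq : S.pd₁ j a = S.mdl₁ j t ht hc a := S.pd₁_eq_mdl₁ j t ht hc hat
  have hL : HasFDerivAt (S.sectorMap j t ht hc) ((L₁.symm.trans L₂ : (𝔼 n) ≃L[ℝ] 𝔼 n) :
      (𝔼 n) →L[ℝ] 𝔼 n) (S.pd₁ j a) := by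
    have hL₁s' : HasFDerivAt (S.sectorChart j t ht hc).symm (L₁.symm : (𝔼 n) →L[ℝ] 𝔼 n)
        (S.pd₁ j a) := by rw [hz₁eq]; exact hL₁s
    have h := hku.comp (S.pd₁ j a) hL₁s'
    convert h using 1 <;> rfl
  exact exists_sector_bounds (S.isOpen_sectorChart_target j t ht hc) hz₁
    (S.contDiffOn_sectorMap j t ht hc) _ hL

end Models

end SweepData

end Literature.Topology.FourManifolds
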